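import Summits.RiemannHypothesis.RiemannHypothesis.Theorems.GroundBartaEvenWinsBeyondArchDeflationUpperY
import Summits.RiemannHypothesis.RiemannHypothesis.Theorems.GroundBartaEvenWinsBeyondArchArchM75YW75e1
import HarnessLib

/-!
# The parity ladder beyond `log 2`: U-side at `b = 3/4` — `ε(3/4) ≤ 1/(14·10¹²)`

Support file (GroundBarta rung 4 / WeilParity item stmt-RiemannHypothesis-18085, helper), RH-free.  Prover A (gen 2).
Rayleigh–Ritz upper bound of the ground energy at the window `3/4` from the A-layer certificates of the even degree-`26`
trial vector `w75e1` (`w75e1_T`), the exact norm `(3/4)·∫P²` and the Markov bracket `m75_markov_mem`: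
`ε(3/4) ≤ Thi/‖v‖² − Mlo = 6.354764e-14 ≤ 1/(14·10¹²)` (`dt_groundEnergy_le_of_T`).  This is the U-side of the cell
`[3/4, ·]` of the ladder (the L-side of a cell `[a₁, a₂]` must exceed the U-side at `a₁`).
-/

set_option linter.dupNamespace false

noncomputable section

namespace Summit.RiemannHypothesis.RiemannHypothesis.Theorems.EvenWinsBeyondArch

open Literature.NumberTheory.LFunctions Literature.Analysis.ValidatedNumerics.ExpPoly
open Literature.Analysis.ValidatedNumerics.PolyMP Literature.NumberTheory.LFunctions.WeilArchPanelsM75Y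

set_option maxHeartbeats 0 in
/-- The exact `∫_{-1}^{1} P²` of the U-side trial vector. [folklore] -/
theorem w75e1_IQ : integPolyQ w75e1P w75e1P 1 = ((20918329095561044857636936136941738482753765059783873548798339 : ℚ)/15688746821670783643235627184329325816737805689889381521817600) := by decide +kernel

/-- **`ε(3/4) ≤ 1/(14·10¹²)`** (U-side at `3/4`). [folklore] -/
theorem trialUpper75 : weilGroundEnergy (3 / 4 : ℝ) ≤ (1 / 14000000000000 : ℝ) := by
  have hT := w75e1_T
  have hM := m75_markov_mem
  have h := dt_groundEnergy_le_of_T w75e1P w75e1E (b := 3 / 4) (by norm_num) w75e1_hE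
    (Thi := 11191651937975272913615659023457738906007729945674041174750545309962821060986067211093119308344842910463316083573930167625242736516421564383/1346095823395176631766248578664034819110922839115348049920000000000000000000000000000000000000000000000000000000000000000000000000000000000) (Mlo := 8314156944449285937 / 1000000000000000000)
    (by push_cast at hT ⊢; exact hT.2) (by push_cast at hM ⊢; exact hM.1) (by rw [w75e1_IQ]; norm_num)
  rw [w75e1_IQ] at h
  push_cast at h
  refine le_trans h ?_
  norm_num

end Summit.RiemannHypothesis.RiemannHypothesis.Theorems.EvenWinsBeyondArch

end
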